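import Summits.CriticalPhenomena.PercolationContinuityZ3.Theorems.PercNearOneGluingNoHeavyLowerTailAPLTwoThirdsLeSix
import Summits.CriticalPhenomena.PercolationContinuityZ3.Theorems.PercNearOneGluingNoHeavyLowerTailOneCutFiveThreePortApl
import HarnessLib

/-!
# `Z(3,2)` at every THREE-PORT observer of every weighted graph with at most six vertices
# (the APL₁ hypotheses of `ThreePort.pocketExchange_of_apl` discharged by the two-copy APL certificates)

builds on p205010 (kernel theorem, internal audit signed; external expert review pending)

Support file (`--supports stmt-CriticalPhenomena-4575`), seat `prim-cert-1` (gen 11, landed gen 13); memo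
`run/shared/lean/prim/prim-cert-1/FROM-prim-cert-1-g11-FIBRE-APL.md`.  No definitions, no sorries; COMPUTATIONAL by inheritance
(`AplKron.apl23_of_card_le_six` rests on four `native_decide` certificate checks).

* `AplKron.apl_three_tenths_of_card_le_six` — the row APL₁ in the exact shape used as a HYPOTHESIS by prim-ineq-gen-8's
  `ThreePort.pocketExchange_of_apl` / `pocketExchange_of_forall_apl`, with the constant `3/10`, for every weight vector on `Fin n`, `n ≤ 6`,
  and all pairwise distinct `x, y, z` (from `AplKron.apl1_of_card_le_six`, constant `2/3 ≥ 3/10`).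
* `AplKron.threePort_pocketExchange_of_card_le_six` — hence, for `n ≤ 6`, at every three-port observer `o` onto distinct `a, b, c`
  (every other pair at `o` has weight `0`) with `Σ_v P(o ↔ v) ≥ 2` and `a` the weakest target: `P(B = {a}) ≤ P(B = {b, c})` — the conclusion
  of `Z(3,2)` (`OneCutFive.ZeroOneThree`).  At `n = 6` this is a NEW cell: three-port `o ∉ A` with two Steiner vertices is exactly where no
  bidegree-2 FAR certificate exists (prim-cert-1 g10, face `{01,02,03,14,15,25,34,45}`); it falls to the APL certificate + the three-port reduction.
-/

noncomputable section

namespace Summit.CriticalPhenomena.PercolationContinuityZ3.Theorems.AplKron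

open MeasureTheory Set
open Literature.Probability.Percolation Literature.Probability.LatticeModels
open scoped Classical

variable {n : ℕ}

/-- The exactly-one event as a disjoint union of the two one-sided events. [this work] -/
theorem exactlyOne_eq_union (x y z : Fin n) :
    exactlyOne x y z = (openConn x y ∩ (openConn x z)ᶜ : Set (BondConfig (Fin n))) ∪ (openConn x z ∩ (openConn x y)ᶜ) := by
  ext ω
  simp only [exactlyOne, mem_setOf_eq, mem_union, mem_inter_iff, mem_compl_iff]
  tauto

/-- **APL₁(3/10) on at most six vertices, in `ThreePort`'s hypothesis shape.**  For `n ≤ 6`, every weight vector `u` on `Fin n` and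
pairwise distinct `x, y, z`: `(3/10)·P(x|y|z)·P(x ↔ y ∧ x ↔ z) ≤ P(x ↔ y, x ↮ z) + P(x ↔ z, x ↮ y)`.  COMPUTATIONAL (via
`apl1_of_card_le_six`, whose constant is `2/3`). [this work] -/
theorem apl_three_tenths_of_card_le_six (hn : n ≤ 6) (u : Sym2 (Fin n) → unitInterval) (x y z : Fin n)
    (hxy : x ≠ y) (hxz : x ≠ z) (hyz : y ≠ z) :
    (3 / 10 : ℝ) * (prodBernoulli u).real ((openConn x y)ᶜ ∩ (openConn x z)ᶜ ∩ (openConn y z)ᶜ) *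
        (prodBernoulli u).real (openConn x y ∩ openConn x z) ≤
      (prodBernoulli u).real (openConn x y ∩ (openConn x z)ᶜ) +
        (prodBernoulli u).real (openConn x z ∩ (openConn x y)ᶜ) := by
  set μ := prodBernoulli u with hμ
  have h0 : ((openConn x y)ᶜ ∩ (openConn x z)ᶜ ∩ (openConn y z)ᶜ : Set (BondConfig (Fin n))) ⊆ (openConn y z)ᶜ :=
    fun ω hω => hω.2
  have h3 : (openConn x y ∩ openConn x z : Set (BondConfig (Fin n))) ⊆ (openConn x y ∪ openConn x z) :=
    fun ω hω => Or.inl hω.1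
  have key := apl1_of_card_le_six hn u x y z hxy hxz hyz _ _ h0 h3
  have hdisj : Disjoint (openConn x y ∩ (openConn x z)ᶜ : Set (BondConfig (Fin n))) (openConn x z ∩ (openConn x y)ᶜ) := by
    rw [Set.disjoint_left]
    intro ω h1 h2
    exact h2.2 h1.1
  have hunion : μ.real (exactlyOne x y z) =
      μ.real (openConn x y ∩ (openConn x z)ᶜ) + μ.real (openConn x z ∩ (openConn x y)ᶜ) := by
    rw [exactlyOne_eq_union, measureReal_union hdisj (Set.toFinite _).measurableSet]
  have hP : 0 ≤ μ.real ((openConn x y)ᶜ ∩ (openConn x z)ᶜ ∩ (openConn y z)ᶜ : Set (BondConfig (Fin n))) *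
      μ.real (openConn x y ∩ openConn x z) := mul_nonneg measureReal_nonneg measureReal_nonneg
  rw [← hunion]
  nlinarith [key, hP]

/-- **`Z(3,2)` at three-port observers, `n ≤ 6`.**  For every weight vector `w` on `Fin n` with `n ≤ 6`, every three-port observer `o`
onto pairwise distinct `a, b, c ≠ o` (all other pairs at `o` have weight `0`) with `P(o ↔ a) + P(o ↔ b) + P(o ↔ c) ≥ 2` and `a` the weakest
target: `P(o ↔ a, o ↮ b, o ↮ c) ≤ P(o ↮ a, o ↔ b, o ↔ c)`.  (`ThreePort.pocketExchange_of_apl` with its three APL₁(3/10) hypotheses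
discharged by `apl_three_tenths_of_card_le_six`; COMPUTATIONAL by inheritance.) [this work] -/
theorem threePort_pocketExchange_of_card_le_six (hn : n ≤ 6) (w : Sym2 (Fin n) → unitInterval) (o a b c : Fin n)
    (hao : a ≠ o) (hbo : b ≠ o) (hco : c ≠ o) (hab : a ≠ b) (hac : a ≠ c) (hbc : b ≠ c)
    (hobs : ∀ u, u ≠ o → u ≠ a → u ≠ b → u ≠ c → w s(o, u) = 0)
    (hsum : 2 ≤ (prodBernoulli w).real (openConn o a) + (prodBernoulli w).real (openConn o b) +
      (prodBernoulli w).real (openConn o c))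
    (hqab : (prodBernoulli w).real (openConn o a) ≤ (prodBernoulli w).real (openConn o b))
    (hqac : (prodBernoulli w).real (openConn o a) ≤ (prodBernoulli w).real (openConn o c)) :
    (prodBernoulli w).real {ω | ω ∈ openConn o a ∧ ω ∉ openConn o b ∧ ω ∉ openConn o c} ≤
      (prodBernoulli w).real {ω | ω ∉ openConn o a ∧ ω ∈ openConn o b ∧ ω ∈ openConn o c} := by
  set u : Sym2 (Fin n) → unitInterval := fun e => if o ∈ e then (0 : unitInterval) else w e with hu
  have hA := apl_three_tenths_of_card_le_six hn u a b c hab hac hbc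
  have hB := apl_three_tenths_of_card_le_six hn u b a c hab.symm hbc hac
  have hC := apl_three_tenths_of_card_le_six hn u c a b hac.symm hbc.symm hab
  -- relabel the `b`- and `c`-instances into the `a`-dictionary (as in `ThreePort.pocketExchange_of_forall_apl`)
  have eT1 : ((openConn b a)ᶜ ∩ (openConn b c)ᶜ ∩ (openConn a c)ᶜ : Set (BondConfig (Fin n))) =
      (openConn a b)ᶜ ∩ (openConn a c)ᶜ ∩ (openConn b c)ᶜ := by
    rw [openConn_comm b a]; ext ω; simp only [mem_inter_iff, mem_compl_iff]; tauto
  have eT2 : ((openConn c a)ᶜ ∩ (openConn c b)ᶜ ∩ (openConn a b)ᶜ : Set (BondConfig (Fin n))) =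
      (openConn a b)ᶜ ∩ (openConn a c)ᶜ ∩ (openConn b c)ᶜ := by
    rw [openConn_comm c a, openConn_comm c b]; ext ω; simp only [mem_inter_iff, mem_compl_iff]; tauto
  have e31 : (openConn b a ∩ openConn b c : Set (BondConfig (Fin n))) = openConn a b ∩ openConn a c := by
    ext ω; simp only [mem_inter_iff, openConn, mem_setOf_eq]
    constructor
    · rintro ⟨h1, h2⟩; exact ⟨h1.symm, h1.symm.trans h2⟩
    · rintro ⟨h1, h2⟩; exact ⟨h1.symm, h1.symm.trans h2⟩
  have e32 : (openConn c a ∩ openConn c b : Set (BondConfig (Fin n))) = openConn a b ∩ openConn a c := by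
    ext ω; simp only [mem_inter_iff, openConn, mem_setOf_eq]
    constructor
    · rintro ⟨h1, h2⟩; exact ⟨h1.symm.trans h2, h1.symm⟩
    · rintro ⟨h1, h2⟩; exact ⟨h2.symm, h2.symm.trans h1⟩
  rw [eT1, e31, openConn_comm b a] at hB
  rw [eT2, e32, openConn_comm c a, openConn_comm c b] at hC
  exact ThreePort.pocketExchange_of_apl w o a b c hao hbo hco hab hac hbc hobs hsum hqab hqac hA hB hC

end Summit.CriticalPhenomena.PercolationContinuityZ3.Theorems.AplKron

end
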